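import Summits.ResolutionOfSingularities.ResolutionOfSingularities.Theses.FrobeniusLadder

/-!
# `FInjectiveMacaulayfication` — negative lemma: the residual point `P` of `Bl_C(f_cusp)` fails
# Fedder's test in EVERY characteristic (a weight count; no arithmetic)

Support (negative) lemma for crux `stmt-ResolutionOfSingularities-15315`
(`Summit.ResolutionOfSingularities.ResolutionOfSingularities.Theses.FrobeniusLadder.FInjectiveMacaulayfication`),
filed by the crux-chain triager res-L1-w45a-tri-1 (TRIAGE v8 §20 F21). [OURS · L1 W4.5a] — NOT a
statement of the manuscript under review; AI-written, weaker than expert review. This file declares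
NO definition and NO notation.

Context. In the hole-#3 specimen `f_cusp = z² + (x²+y³)³ + w⁵` the blow-up of the bad curve
`C = V(z, w, x²+y³)` leaves (idea-2, ANSWERS-r3 §3, `Sketch-r3-idea-2.lean`) one residual point
`P = V(F₁, F₂) ⊂ 𝔸⁵`, `F₁ = x² + y³ − U′w`, `F₂ = Z′² + wU′³ + w³` (variables
`0 = x, 1 = y, 2 = w, 3 = Z′, 4 = U′`), a complete intersection of embedding dimension 5. Fedder's
criterion for the complete intersection says `P` is NOT F-pure iff `(F₁F₂)^(p-1) ∈ 𝔪^[p] = (xᵢ^p)`;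
idea-2 verified that membership by exact arithmetic for `p = 5, 7, 11, 13` and typed it as the stub
`PResidualNotFPure 5`.

* `residualP_fedderProduct_pow_mem_span_X_pow` — **for every commutative ring `R` and every
  `n ≥ 1`, `(F₁F₂)ⁿ ∈ (xᵢ^(n+1) : i)`.** Proof: with weights `w = (15, 10, 18, 27, 12)` both
  `F₁` (weight 30) and `F₂` (weight 54) are weighted homogeneous, so every monomial of `(F₁F₂)ⁿ`
  weighs `84·n`, whereas a monomial all of whose exponents are `≤ n` weighs at most
  `(15+10+18+27+12)·n = 82·n < 84·n`; hence every monomial of `(F₁F₂)ⁿ` has an exponent `≥ n+1`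
  (`MvPolynomial.mem_ideal_span_monomial_image`). This is the graded statement
  `a = Σ deg − Σ wt = 84 − 82 = 2 > 0`.
* `residualP_fedderProduct_mem_frobeniusPower` — the case `n = p − 1`: `(F₁F₂)^(p-1) ∈ (xᵢ^p : i)`
  for every `p ≥ 2` over every commutative ring; with `R = ZMod p` (or any field of characteristic
  `p`) this is idea-2's `PResidualNotFPure p` for ALL primes `p` at once — `P` is a bad point in
  every characteristic (like `f_cusp`'s own origin: weights (15,10,45,18), degree 90 > 88), so the
  graded point engine's calibration on `P` is characteristic-free, and wild at `p = 3, 5`.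
[folklore: the a-invariant obstruction to F-purity of a graded complete intersection]
-/

-- single-problem summit: the doubled namespace component `ResolutionOfSingularities` is forced
set_option linter.dupNamespace false

namespace Summit.ResolutionOfSingularities.ResolutionOfSingularities.Theorems.FInjectiveMacaulayfication.Negative

open MvPolynomial

/-- **Weight count.** For every commutative ring `R` and `n ≥ 1`,
`((x²+y³−U′w)·(Z′²+wU′³+w³))ⁿ ∈ (x^(n+1), y^(n+1), w^(n+1), Z′^(n+1), U′^(n+1))` in
`R[x, y, w, Z′, U′] = MvPolynomial (Fin 5) R` (indices `0,1,2,3,4`): both factors are weighted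
homogeneous for `w = (15,10,18,27,12)` of weights `30` and `54`, and `84·n > 82·n`. -/
theorem residualP_fedderProduct_pow_mem_span_X_pow (R : Type*) [CommRing R] (n : ℕ) (hn : 1 ≤ n) :
    (((X 0 ^ 2 + X 1 ^ 3 - X 4 * X 2) * (X 3 ^ 2 + X 2 * X 4 ^ 3 + X 2 ^ 3)) ^ n :
        MvPolynomial (Fin 5) R)
      ∈ Ideal.span (Set.range fun i : Fin 5 => (X i : MvPolynomial (Fin 5) R) ^ (n + 1)) := by
  classical
  set w : Fin 5 → ℕ := ![15, 10, 18, 27, 12] with hw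
  have hX : ∀ i : Fin 5, IsWeightedHomogeneous w (X i : MvPolynomial (Fin 5) R) (w i) :=
    fun i => isWeightedHomogeneous_X (R := R) w i
  -- `F₁ = x² + y³ − U′w` is `w`-homogeneous of weight 30
  have h1 : IsWeightedHomogeneous w (X 0 ^ 2 + X 1 ^ 3 - X 4 * X 2 : MvPolynomial (Fin 5) R) 30 := by
    have a : IsWeightedHomogeneous w (X 0 ^ 2 : MvPolynomial (Fin 5) R) 30 := by
      simpa [hw] using (hX 0).pow 2
    have b : IsWeightedHomogeneous w (X 1 ^ 3 : MvPolynomial (Fin 5) R) 30 := by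
      simpa [hw] using (hX 1).pow 3
    have c : IsWeightedHomogeneous w (X 4 * X 2 : MvPolynomial (Fin 5) R) 30 := by
      simpa [hw] using (hX 4).mul (hX 2)
    have hsub := (weightedHomogeneousSubmodule R w 30).sub_mem
      ((weightedHomogeneousSubmodule R w 30).add_mem
        ((mem_weightedHomogeneousSubmodule R w 30 _).mpr a)
        ((mem_weightedHomogeneousSubmodule R w 30 _).mpr b))
      ((mem_weightedHomogeneousSubmodule R w 30 _).mpr c)
    exact (mem_weightedHomogeneousSubmodule R w 30 _).mp hsub
  -- `F₂ = Z′² + wU′³ + w³` is `w`-homogeneous of weight 54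
  have h2 : IsWeightedHomogeneous w
      (X 3 ^ 2 + X 2 * X 4 ^ 3 + X 2 ^ 3 : MvPolynomial (Fin 5) R) 54 := by
    have a : IsWeightedHomogeneous w (X 3 ^ 2 : MvPolynomial (Fin 5) R) 54 := by
      simpa [hw] using (hX 3).pow 2
    have b : IsWeightedHomogeneous w (X 2 * X 4 ^ 3 : MvPolynomial (Fin 5) R) 54 := by
      simpa [hw] using (hX 2).mul ((hX 4).pow 3)
    have c : IsWeightedHomogeneous w (X 2 ^ 3 : MvPolynomial (Fin 5) R) 54 := by
      simpa [hw] using (hX 2).pow 3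
    exact (a.add b).add c
  -- hence the product to the `n` is `w`-homogeneous of weight `84 n`
  have h12 : IsWeightedHomogeneous w
      (((X 0 ^ 2 + X 1 ^ 3 - X 4 * X 2) * (X 3 ^ 2 + X 2 * X 4 ^ 3 + X 2 ^ 3)) ^ n :
        MvPolynomial (Fin 5) R) (n * 84) := by
    simpa using (h1.mul h2).pow n
  -- the Frobenius-power ideal is the monomial ideal on the exponents `single i (n+1)`
  have hset : (Set.range fun i : Fin 5 => (X i : MvPolynomial (Fin 5) R) ^ (n + 1))
      = (fun s => monomial s (1 : R)) '' Set.range (fun i : Fin 5 => Finsupp.single i (n + 1)) := by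
    rw [← Set.range_comp]
    congr 1
    funext i
    simp [Function.comp, X_pow_eq_monomial]
  rw [hset, mem_ideal_span_monomial_image]
  intro d hd
  have hwd : Finsupp.weight w d = n * 84 := h12 (mem_support_iff.mp hd)
  by_contra hcon
  push Not at hcon
  have hle : ∀ i : Fin 5, d i ≤ n := by
    intro i
    by_contra hi
    push Not at hi
    exact hcon (Finsupp.single i (n + 1)) ⟨i, rfl⟩ (Finsupp.single_le_iff.mpr (by omega))
  rw [Finsupp.weight_apply, Finsupp.sum_fintype _ _ (fun i => by simp)] at hwd
  simp only [Fin.sum_univ_five, smul_eq_mul, hw, Matrix.cons_val_zero, Matrix.cons_val_one,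
    Matrix.head_cons, Matrix.cons_val_two, Matrix.cons_val_three, Matrix.cons_val_four,
    Matrix.tail_cons] at hwd
  have h0 := hle 0
  have h1' := hle 1
  have h2' := hle 2
  have h3 := hle 3
  have h4 := hle 4
  omega

/-- **Fedder's colon element of `P` lies in the Frobenius power of `𝔪`, in every
characteristic.** For every commutative ring `R` and every `p ≥ 2`,
`((x²+y³−U′w)·(Z′²+wU′³+w³))^(p-1) ∈ (x^p, y^p, w^p, Z′^p, U′^p)`; over a field of characteristic
`p` this is the statement «`P = V(x²+y³−U′w, Z′²+wU′³+w³)` is not F-pure at the origin» in Fedder's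
complete-intersection form (idea-2's `PResidualNotFPure p`, for all `p` at once). -/
theorem residualP_fedderProduct_mem_frobeniusPower (R : Type*) [CommRing R] (p : ℕ) (hp : 2 ≤ p) :
    (((X 0 ^ 2 + X 1 ^ 3 - X 4 * X 2) * (X 3 ^ 2 + X 2 * X 4 ^ 3 + X 2 ^ 3)) ^ (p - 1) :
        MvPolynomial (Fin 5) R)
      ∈ Ideal.span (Set.range fun i : Fin 5 => (X i : MvPolynomial (Fin 5) R) ^ p) := by
  have h := residualP_fedderProduct_pow_mem_span_X_pow R (p - 1) (by omega)
  have hp' : p - 1 + 1 = p := by omega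
  rw [hp'] at h
  exact h

end Summit.ResolutionOfSingularities.ResolutionOfSingularities.Theorems.FInjectiveMacaulayfication.Negative
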